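import Summits.Ventures.QEC.CircuitDistance.PortK2DataBB144Z
import Summits.Ventures.QEC.CircuitDistance.K2Chunks
import HarnessLib

/-!
# K2(`[[144,12,12]]`) chunk module — COMPUTATIONAL (native_decide; `Lean.ofReduceBool`)

Cell `qec`, CDX, R146/R152 STEP 1 («computational» header; `ofReduceBool` confined to these chunk modules). Checker of record
`K2.K2Data` (qec-cdx-type-1, PortK2Check); data module of record `PortK2DataBB144X/Z` (p669158/9, crit-1 data audit PASS
2026-08-28T21:20Z); chunk glue `K2Chunks` (idea-1 g2). Cube 0, child 7: leaf group 6 of 11.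
Leaf theorems: the K2 DFS accepts below one descendant state of pivot cube 0 (sector Z); sizes are exact DFS visit counts
(eng-1 g2 `k2count.c`), capped so that the gate's native-axiom audit re-verifies every leaf in place. Assemblies re-derive the
child lists in the kernel (`decide`) and end in the literal cube fact `d144Z.cube (Ts144Z.getD 0 []) (0) (lives144Z.getD 0 0) = true`
(the `hcubes` hypothesis of `K2Inst.k2_complete`). Emitted by qec-cdx-eng-1 g2 (`gen2.py`, idea-1's `gen_k2chunks_from_lean.py` lineage).
-/

namespace Summit.Ventures.QEC.CircuitDistance.K2

set_option maxRecDepth 100000 in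
set_option maxHeartbeats 0 in
set_option exponentiation.threshold 1024 in
/-- K2(144) chunk fact `cube144Z0_ch7_6` (510321 DFS visits; see the module docstring). -/
theorem cube144Z0_ch7_6 : app5 (d144Z.dfs (Ts144Z.getD 0 []) 6) (2971115309118817051904, 456, 94198347718593352149846873983666679001261277185, 3, 2348542582773833227889480596789337027375682548908319870707290875371395729050561456218691333226725915089698780) = true := by native_decide

set_option maxRecDepth 100000 in
set_option maxHeartbeats 0 in
set_option exponentiation.threshold 1024 in
/-- K2(144) chunk fact `cube144Z0_ch7_7` (578409 DFS visits; see the module docstring). -/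
theorem cube144Z0_ch7_7 : app5 (d144Z.dfs (Ts144Z.getD 0 []) 6) (1774382224386956487680, 2504, 274031556999544297163190906134303066185487351809, 3, 2348542582773833227889480596789337027375682548908319870707290692683691062687696680758087243691348458098130908) = true := by native_decide

set_option maxRecDepth 100000 in
set_option maxHeartbeats 0 in
set_option exponentiation.threshold 1024 in
/-- K2(144) chunk fact `cube144Z0_ch7_8` (891310 DFS visits; see the module docstring). -/
theorem cube144Z0_ch7_8 : app5 (d144Z.dfs (Ts144Z.getD 0 []) 6) (891208323061094822976, 1864, 23475370049627628123646687625505296003223416471553, 3, 2348542582773833227889480596789337027375682548908319870707267308657493768241005421800763783163033963177443292) = true := by native_decide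
end Summit.Ventures.QEC.CircuitDistance.K2
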